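import Summits.MatrixMultiplication.OmegaCensus.STPPVosperSlackTwoCheckersTP
import Summits.MatrixMultiplication.OmegaCensus.STPPVosperSlackTwoTablesZ53
import Summits.MatrixMultiplication.OmegaCensus.STPPVosperSlackTwoLawABQ

/-!
# ω-census (abelian STPP census): ℤ₅₃ leaf {(2,3,3)³} — slack-2 three-block law, case C rows, part 3 (kernel computations)

HONEST FRAMING (pub-omega census; verbatim): lottery ticket; floor = certified bounds/negative ranges.
Census STRUCTURE (seat pub-omega-stpp-2 gen 31, 2026-08-29), family (b2).  Rows for the three-block slack-2 law `no_isSTPP_of_slack_two_tables`, case C (PRUNED checker `caseCDeadTP` of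
`STPPVosperSlackTwoCheckersTP.lean`, dead table `tblZ53C = []` of `…TablesZ53.lean` — at `p = 53` no case-C leaf is reached):
`caseCDeadTP 53 3 18 12 Q P h₀ tblZ53C = true` for `Q ∈ qShapesC 3`, `P ∈ pShapesC 53 2` (52 shapes `[0, d]`), `h₀ ∈ [1, 12]`.  Light `P`-ranges are one `decide` each;
the four heavy `P` (`d = 3, 4, 49, 50`) are split by `Q` and glued back in the same file; every `decide` ≤ 15000 mirror units (HOME `pub-omega-stpp-2-g31/code/s2/units53.py`,
farm calibration of the ℤ₅₉ programme ≈ 3.9 ms/unit).  Assembly in `STPPVosperSlackTwoRows53CAsm.lean`.  Nothing here is progress on `ω`.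
-/

namespace Summit.MatrixMultiplication.OmegaCensus.CubeNB.S2

/-- Case C rows, `P`-indices `[16, 28)` (all `Q`, all holes): one `decide`. [folklore] -/
theorem rows53C_r16_12 : ((((pShapesC 53 2).drop 16).take 12).all fun P => (qShapesC 3).all fun Q => (List.range' 1 12).all fun h₀ => caseCDeadTP 53 3 18 12 Q P h₀ tblZ53C) = true := by
  decide +kernel

/-- Case C rows, `P`-indices `[28, 36)` (all `Q`, all holes): one `decide`. [folklore] -/
theorem rows53C_r28_8 : ((((pShapesC 53 2).drop 28).take 8).all fun P => (qShapesC 3).all fun Q => (List.range' 1 12).all fun h₀ => caseCDeadTP 53 3 18 12 Q P h₀ tblZ53C) = true := by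
  decide +kernel

/-- Case C rows, `P`-indices `[36, 41)` (all `Q`, all holes): one `decide`. [folklore] -/
theorem rows53C_r36_5 : ((((pShapesC 53 2).drop 36).take 5).all fun P => (qShapesC 3).all fun Q => (List.range' 1 12).all fun h₀ => caseCDeadTP 53 3 18 12 Q P h₀ tblZ53C) = true := by
  decide +kernel

/-- Case C rows, `P`-indices `[41, 44)` (all `Q`, all holes): one `decide`. [folklore] -/
theorem rows53C_r41_3 : ((((pShapesC 53 2).drop 41).take 3).all fun P => (qShapesC 3).all fun Q => (List.range' 1 12).all fun h₀ => caseCDeadTP 53 3 18 12 Q P h₀ tblZ53C) = true := by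
  decide +kernel

end Summit.MatrixMultiplication.OmegaCensus.CubeNB.S2
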